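import Summits.QuantumFields.YangMills.Theorems.LangevinControlUVOSLegsFromFemtoAndGapDefsR3
import Summits.QuantumFields.YangMills.Theorems.LangevinControlUVOSLegsFromFemtoAndGapStubAssemblyRPExpansion
import Summits.QuantumFields.YangMills.Theorems.FradkinShenkerFlowFiniteSusceptibilityWeakCouplingRPCauchySchwarz
import Literature.MathematicalPhysics.QuantumFieldTheory.SpeciesLatticeProducts
import Literature.MathematicalPhysics.QuantumLattice.ReflectedCorrelationPolarisation
import HarnessLib

/-!
# Stub `stub_rope` of line `Sketch` (crux `OSLegsAtWeakCouplingC`, stmt-QuantumFields-16207) — helper: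
# the H3 anchor of the reflection-positivity rope

Helper file for stub `stub_rope` (DefsR3 §4.4).  The `Decay` half of the rope controls the reflected, time-shifted
connected autocorrelation `x(j) = osCorr(μ_{β,2L+1}, Θ, τ_j)(X, X)` of a smeared plane-string field
`X = fieldObs r L s F m` (toolkit XVII; `m` the torus plane means) by Hankel log-convexity GIVEN a far-separation
bound; this file supplies the far bound from H3 (`GapInUnits`):

* §1 abstract bookkeeping: `osCorr` is sesquilinear over finite linear combinations of bounded measurable functions
  (`osCorr_sum_sum`), whence a double-sum bound with a uniform pair constant (`norm_osCorr_sum_le`);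
* §2 products of plane fields over a finite index set are Yang–Mills species (`exists_species_prod_plane`), and the
  reflected shifted correlation of two such products on the odd torus IS the tree's `latticeConnectedCorr` of the
  reflected species (sites `thetaSite`) and the unreflected one (`osCorr_prodPlane_eq`: reflection law of the plane
  fields, `torusLift_torusTimeShift`, and `Θ`-invariance of Wilson's measure for the mean);
* §3 the smeared field is a finite linear combination `Σ_{q, y ∈ box Rⁿ, S ⊆ [n]} F(s y) ∏_{l ∉ S}(−m_{q l}) · ∏_{l∈S} plane`
  (`fieldObs_eq_sum`: the test function vanishes off `box R`, the centred products are expanded over subsets);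
* §4 `exists_anchor` (registered): H3 applied to the (β-independent) uncentred species, the species-dependent
  constants absorbed into `D n R` (a sum of the H3 constants over the finite family of strings in `box R`, monotone
  in `R`), the centring constants into `(max 1 Cp)^{2n}`, and the subset count into `4ⁿ`.

Refs: OsterwalderSeiler1978 §2; GlimmJaffe1987 §6.1, §19.3.
-/

set_option autoImplicit false

noncomputable section

open scoped SchwartzMap ComplexConjugate BigOperators
open MeasureTheory Filter Topology
open Literature.MathematicalPhysics.QuantumFieldTheory Literature.MathematicalPhysics.QuantumLattice
open Literature.MathematicalPhysics.AQFT
open Literature.Probability.LatticeModels (box Site box_mono)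
open Summit.QuantumFields.YangMills.Cruxes.OSLegsFromFemtoAndGap.DlrCollarTransfer
open Summit.QuantumFields.YangMills.Theorems.OSLegsFromFemtoAndGap
open Summit.QuantumFields.YangMills.Theorems.FiniteSusceptibilityWeakCoupling.RPCauchySchwarz
  (wilsonMeasure_map_timeReflect)

namespace Summit.QuantumFields.YangMills.Theorems.OSLegsAtWeakCouplingC

local notation "E4" => EuclideanSpace ℝ (Fin 4)

namespace Anchor

/-! ## §1 Abstract bookkeeping: sesquilinearity of `osCorr` over finite sums -/

section Abstract

variable {Ω ι : Type*} [MeasurableSpace Ω] {μ : Measure Ω} [IsFiniteMeasure μ] {Θ τ : Ω → Ω}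

/-- **Sesquilinear expansion of `osCorr` over a finite linear combination** of bounded measurable functions:
`osCorr(Σ cᵢ Xᵢ, Σ cⱼ Xⱼ) = Σᵢⱼ c̄ᵢ cⱼ osCorr(Xᵢ, Xⱼ)`. -/
theorem osCorr_sum_sum (hΘ : Measurable Θ) (hτ : Measurable τ) (s : Finset ι) (c : ι → ℂ) {X : ι → Ω → ℂ}
    (hX : ∀ i, Measurable (X i)) (hbX : ∀ i, ∃ B, ∀ ω, ‖X i ω‖ ≤ B) :
    osCorr μ Θ τ (fun ω => ∑ i ∈ s, c i * X i ω) (fun ω => ∑ i ∈ s, c i * X i ω) =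
      ∑ i ∈ s, ∑ j ∈ s, conj (c i) * c j * osCorr μ Θ τ (X i) (X j) := by
  have hij : ∀ i j, Integrable (fun ω => conj (X i (Θ ω)) * X j (τ ω)) μ := fun i j =>
    integrable_conj_comp_mul_comp hΘ hτ (hX i) (hbX i) (hX j) (hbX j)
  have hi : ∀ i, Integrable (X i) μ := fun i => integrable_of_measurable_bounded (hX i) (hbX i)
  have h1 : ∫ ω, conj (∑ i ∈ s, c i * X i (Θ ω)) * ∑ j ∈ s, c j * X j (τ ω) ∂μ =
      ∑ i ∈ s, ∑ j ∈ s, conj (c i) * c j * ∫ ω, conj (X i (Θ ω)) * X j (τ ω) ∂μ := by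
    have e : ∀ ω, conj (∑ i ∈ s, c i * X i (Θ ω)) * ∑ j ∈ s, c j * X j (τ ω) =
        ∑ i ∈ s, ∑ j ∈ s, conj (c i) * c j * (conj (X i (Θ ω)) * X j (τ ω)) := by
      intro ω
      rw [map_sum, Finset.sum_mul]
      refine Finset.sum_congr rfl fun i _ => ?_
      rw [Finset.mul_sum]
      refine Finset.sum_congr rfl fun j _ => ?_
      rw [map_mul]
      ring
    simp_rw [e]
    rw [integral_finsetSum _ fun i _ => integrable_finsetSum _ fun j _ => (hij i j).const_mul _]
    refine Finset.sum_congr rfl fun i _ => ?_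
    rw [integral_finsetSum _ fun j _ => (hij i j).const_mul _]
    exact Finset.sum_congr rfl fun j _ => integral_const_mul _ _
  have h2 : ∫ ω, ∑ i ∈ s, c i * X i ω ∂μ = ∑ i ∈ s, c i * ∫ ω, X i ω ∂μ := by
    rw [integral_finsetSum _ fun i _ => (hi i).const_mul _]
    exact Finset.sum_congr rfl fun i _ => integral_const_mul _ _
  unfold osCorr
  rw [h1, h2, map_sum, Finset.sum_mul, ← Finset.sum_sub_distrib]
  refine Finset.sum_congr rfl fun i _ => ?_
  rw [Finset.mul_sum, ← Finset.sum_sub_distrib]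
  refine Finset.sum_congr rfl fun j _ => ?_
  rw [map_mul]
  ring

/-- **Double-sum bound with a uniform pair constant**: if `‖cᵢ‖ ≤ wᵢ B` and `‖osCorr(Xᵢ, Xⱼ)‖ ≤ Kᵢⱼ e` with
`Kᵢⱼ ≥ 0`, then `‖osCorr(Σ cᵢXᵢ, Σ cᵢXᵢ)‖ ≤ (Σ wᵢ)² · (B² Σᵢⱼ Kᵢⱼ) · e`. -/
theorem norm_osCorr_sum_le (hΘ : Measurable Θ) (hτ : Measurable τ) (s : Finset ι) (c : ι → ℂ) {X : ι → Ω → ℂ}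
    (hX : ∀ i, Measurable (X i)) (hbX : ∀ i, ∃ B, ∀ ω, ‖X i ω‖ ≤ B) {w : ι → ℝ} {B : ℝ} (hB : 0 ≤ B)
    (hw : ∀ i ∈ s, ‖c i‖ ≤ w i * B) (hw0 : ∀ i ∈ s, 0 ≤ w i) {K : ι → ι → ℝ} {e : ℝ} (he : 0 ≤ e)
    (hK0 : ∀ i ∈ s, ∀ j ∈ s, 0 ≤ K i j) (hK : ∀ i ∈ s, ∀ j ∈ s, ‖osCorr μ Θ τ (X i) (X j)‖ ≤ K i j * e) :
    ‖osCorr μ Θ τ (fun ω => ∑ i ∈ s, c i * X i ω) (fun ω => ∑ i ∈ s, c i * X i ω)‖ ≤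
      (∑ i ∈ s, w i) ^ 2 * (B * B * ∑ i ∈ s, ∑ j ∈ s, K i j) * e := by
  rw [osCorr_sum_sum hΘ hτ s c hX hbX]
  set Kt := ∑ i ∈ s, ∑ j ∈ s, K i j with hKt
  have hKt' : ∀ i ∈ s, ∀ j ∈ s, K i j ≤ Kt := fun i hi j hj =>
    (Finset.single_le_sum (f := fun j => K i j) (fun j hj => hK0 i hi j hj) hj).trans
      (Finset.single_le_sum (f := fun i => ∑ j ∈ s, K i j)
        (fun i hi => Finset.sum_nonneg fun j hj => hK0 i hi j hj) hi)
  calc ‖∑ i ∈ s, ∑ j ∈ s, conj (c i) * c j * osCorr μ Θ τ (X i) (X j)‖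
      ≤ ∑ i ∈ s, ∑ j ∈ s, (w i * B) * (w j * B) * (Kt * e) := by
        refine (norm_sum_le _ _).trans (Finset.sum_le_sum fun i hi => (norm_sum_le _ _).trans
          (Finset.sum_le_sum fun j hj => ?_))
        rw [norm_mul, norm_mul, RCLike.norm_conj]
        have h3 := (hK i hi j hj).trans (mul_le_mul_of_nonneg_right (hKt' i hi j hj) he)
        exact mul_le_mul (mul_le_mul (hw i hi) (hw j hj) (norm_nonneg _) (mul_nonneg (hw0 i hi) hB)) h3
          (norm_nonneg _) (mul_nonneg (mul_nonneg (hw0 i hi) hB) (mul_nonneg (hw0 j hj) hB))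
    _ = (∑ i ∈ s, w i) ^ 2 * (B * B * Kt) * e := by
        rw [sq, Finset.sum_mul_sum]
        simp_rw [Finset.sum_mul]
        exact Finset.sum_congr rfl fun i _ => Finset.sum_congr rfl fun j _ => by ring

end Abstract

/-! ## §2 Products of plane fields: species, and the reflected shifted correlation as `latticeConnectedCorr` -/

variable {G : Type} [Group G] [TopologicalSpace G] [IsTopologicalGroup G] [CompactSpace G]
  [MeasurableSpace G] [BorelSpace G]

omit [IsTopologicalGroup G] [CompactSpace G] [BorelSpace G] in
/-- The plane field at `x` is the plaquette observable based at `x` (`plaquetteObs ρ 0 i j ∘ τ_{−x} = plaquetteObs ρ x i j`). -/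
theorem plane_eq_plaquetteObs (r : LatticeRep G) (q : Fin 4 × Fin 4) (x : Site 4) (U : LGConfig 4 G) :
    plane G r q x U = plaquetteObs r.ρ x q.1 q.2 U := by
  unfold plane plaquetteObs
  have h : plaquetteHolonomyZd (configShift (-x) U) 0 q.1 q.2 = plaquetteHolonomyZd U x q.1 q.2 := by
    simp [plaquetteHolonomyZd, configShift_apply, add_comm]
  rw [h]

/-- **Products of plane fields over a finite index set are Yang–Mills species** (bounded, measurable,
gauge-invariant cylinder observables; measurability by second countability of `G` from the closed embedding `r.ρ`). -/
theorem exists_species_prod_plane (r : LatticeRep G) {n : ℕ} (S : Finset (Fin n)) (q : Fin n → Fin 4 × Fin 4)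
    (z : Fin n → Site 4) : ∃ A : YMSpecies G, A.F = fun V => ∏ l ∈ S, plane G r (q l) (z l) V := by
  haveI : SecondCountableTopology G :=
    (r.continuous.isClosedEmbedding r.injective).isEmbedding.secondCountableTopology
  obtain ⟨Cp, hCp⟩ := exists_abs_plane_le (G := G) r
  refine ⟨⟨fun V => ∏ l ∈ S, plane G r (q l) (z l) V,
    S.biUnion fun l => (originPlaquetteSupport (q l).1 (q l).2).image fun e => (e.1 - -(z l), e.2),
    fun U V hUV => ?_, fun g U => ?_, ⟨∏ _l ∈ S, Cp, fun U => ?_⟩,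
    Finset.measurable_prod _ fun l _ => (continuous_plane r (q l) (z l)).measurable⟩, rfl⟩
  · exact Finset.prod_congr rfl fun l hl => isCylinder_plane r (q l) (z l)
      (fun e he => hUV e (Finset.mem_coe.2 (Finset.mem_biUnion.2 ⟨l, hl, Finset.mem_coe.1 he⟩)))
  · refine Finset.prod_congr rfl fun l _ => ?_
    rw [plane_eq_plaquetteObs, plane_eq_plaquetteObs]
    exact isZdGaugeInvariant_plaquetteObs r.ρ _ _ _ g U
  · rw [Finset.abs_prod]
    exact Finset.prod_le_prod (fun _ _ => abs_nonneg _) fun l _ => hCp _ _ _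

/-- **The reflected, shifted correlation of two plane products is a `latticeConnectedCorr`**: on the odd torus of
side `2L+1`, for `X = ∏_{l∈S} plane (q l) (y l) ∘ lift`, `Y = ∏_{l∈S'} plane (p l) (y' l) ∘ lift` (valid orientations
on `S`), `osCorr(μ_β, Θ, τ_M)(X, Y) = latticeConnectedCorr β (2L+1) A B M` with `A = ∏_{l∈S} plane (q l) (θ̃ (y l))`,
`B = ∏_{l∈S'} plane (p l) (y' l)`: the reflection law of the plane fields, `lift ∘ τ_M = configShift (−M e₀) ∘ lift`,
and `Θ`-invariance of Wilson's measure for the mean of `X`. -/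
theorem osCorr_prodPlane_eq (r : LatticeRep G) (β : ℝ) (L M : ℕ) {n k : ℕ} {q : Fin n → Fin 4 × Fin 4}
    {S : Finset (Fin n)} (hq : ∀ l ∈ S, (q l).1 < (q l).2) (y : Fin n → Site 4) (p : Fin k → Fin 4 × Fin 4)
    (S' : Finset (Fin k)) (y' : Fin k → Site 4) {A B : YMSpecies G}
    (hA : A.F = fun V => ∏ l ∈ S, plane G r (q l) (thetaSite (q l) (y l)) V)
    (hB : B.F = fun V => ∏ l ∈ S', plane G r (p l) (y' l) V) :
    osCorr (wilsonMeasure (d := 4) (L := 2 * L + 1) r.ρ β) GaugeConfig.timeReflect (⇑(torusTimeShift (2 * L + 1) M))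
        (fun U => ((∏ l ∈ S, plane G r (q l) (y l) (torusLift (2 * L + 1) U) : ℝ) : ℂ))
        (fun U => ((∏ l ∈ S', plane G r (p l) (y' l) (torusLift (2 * L + 1) U) : ℝ) : ℂ)) =
      (latticeConnectedCorr r.ρ β (2 * L + 1) A.F B.F M : ℂ) := by
  set μ := wilsonMeasure (d := 4) (L := 2 * L + 1) (G := G) r.ρ β with hμ
  haveI : IsProbabilityMeasure μ := isProbabilityMeasure_wilsonMeasure (d := 4) (L := 2 * L + 1) r.ρ r.continuous β
  have hΘ : ∀ U : GaugeConfig 4 (2 * L + 1) G,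
      ∏ l ∈ S, plane G r (q l) (y l) (torusLift (2 * L + 1) U.timeReflect) = A.F (torusLift (2 * L + 1) U) := by
    intro U
    rw [hA]
    exact Finset.prod_congr rfl fun l hl => plane_torusLift_timeReflect r _ (hq l hl) _ U
  have hτ : ∀ U : GaugeConfig 4 (2 * L + 1) G,
      ∏ l ∈ S', plane G r (p l) (y' l) (torusLift (2 * L + 1) (torusTimeShift (2 * L + 1) M U)) =
        B.F (configShift (-Pi.single 0 (M : ℤ)) (torusLift (2 * L + 1) U)) := by
    intro U
    rw [hB, torusLift_torusTimeShift]
  have hB' : ∀ U : GaugeConfig 4 (2 * L + 1) G,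
      ∏ l ∈ S', plane G r (p l) (y' l) (torusLift (2 * L + 1) U) = B.F (torusLift (2 * L + 1) U) := by
    intro U
    rw [hB]
  have hmp : MeasurePreserving (GaugeConfig.timeReflect : GaugeConfig 4 (2 * L + 1) G → _) μ μ :=
    ⟨WilsonRP.measurable_timeReflect, wilsonMeasure_map_timeReflect r.ρ r.continuous β⟩
  have hXm : Measurable fun U : GaugeConfig 4 (2 * L + 1) G =>
      ((∏ l ∈ S, plane G r (q l) (y l) (torusLift (2 * L + 1) U) : ℝ) : ℂ) :=
    Complex.measurable_ofReal.comp (Finset.measurable_prod _ fun l _ => measurable_plane_lift r L (q l) (y l))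
  have hmean : ∫ U, ((∏ l ∈ S, plane G r (q l) (y l) (torusLift (2 * L + 1) U) : ℝ) : ℂ) ∂μ =
      ((∫ U, A.F (torusLift (2 * L + 1) U) ∂μ : ℝ) : ℂ) := by
    have h := integral_map hmp.measurable.aemeasurable
      (hXm.aestronglyMeasurable (μ := μ.map GaugeConfig.timeReflect))
    rw [hmp.map_eq] at h
    rw [h]
    simp_rw [hΘ]
    exact integral_complex_ofReal
  unfold osCorr latticeConnectedCorr
  simp_rw [hΘ, hτ, hB', Complex.conj_ofReal, hmean, Complex.conj_ofReal, ← Complex.ofReal_mul]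
  rw [integral_complex_ofReal, integral_complex_ofReal]
  push_cast
  ring

/-! ## §3 The smeared field as a finite linear combination of plane products -/

omit [IsTopologicalGroup G] [CompactSpace G] [BorelSpace G] in
/-- **Expansion of the smeared field**: if `F(s y) ≠ 0` forces every site into `box R` (`R ≤ L`), then
`fieldObs r L s F m = Σ_{q valid} Σ_{y ∈ box Rⁿ} Σ_{S ⊆ [n]} (F(s y) ∏_{l ∉ S} (−m (q l))) · ∏_{l ∈ S} plane (q l) (y l) ∘ lift`. -/
theorem fieldObs_eq_sum (r : LatticeRep G) {L R : ℕ} (hRL : R ≤ L) (s : ℝ) {n : ℕ} (F : 𝓢((Fin n → E4), ℂ))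
    (hF : ∀ y : Fin n → Site 4, F (fun l => s • siteToE (y l)) ≠ 0 → ∀ l, y l ∈ box 4 R ∧ 1 ≤ y l 0)
    (m : Fin 4 × Fin 4 → ℝ) (U : GaugeConfig 4 (2 * L + 1) G) :
    fieldObs r L s F m U =
      ∑ i ∈ (Fintype.piFinset fun _ : Fin n => Finset.univ.filter fun pl : Fin 4 × Fin 4 => pl.1 < pl.2) ×ˢ
          ((Fintype.piFinset fun _ : Fin n => box 4 R) ×ˢ (Finset.univ : Finset (Fin n)).powerset),
        F (fun l => s • siteToE (i.2.1 l)) * (∏ l ∈ Finset.univ \ i.2.2, (-(m (i.1 l) : ℂ))) *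
          ((∏ l ∈ i.2.2, plane G r (i.1 l) (i.2.1 l) (torusLift (2 * L + 1) U) : ℝ) : ℂ) := by
  -- the centred product expanded over subsets
  have hexp : ∀ (q : Fin n → Fin 4 × Fin 4) (y : Fin n → Site 4), (strObs r L q (fun l => m (q l)) y U : ℂ) =
      ∑ S ∈ (Finset.univ : Finset (Fin n)).powerset, (∏ l ∈ Finset.univ \ S, (-(m (q l) : ℂ))) *
        ((∏ l ∈ S, plane G r (q l) (y l) (torusLift (2 * L + 1) U) : ℝ) : ℂ) := by
    intro q y
    unfold strObs
    push_cast
    simp_rw [sub_eq_add_neg]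
    rw [Finset.prod_add]
    exact Finset.sum_congr rfl fun S _ => mul_comm _ _
  rw [Finset.sum_product]
  unfold fieldObs
  refine Finset.sum_congr rfl fun q _ => ?_
  rw [Finset.sum_product]
  symm
  refine (Finset.sum_subset (Fintype.piFinset_subset _ _ fun _ => box_mono 4 hRL) fun y _ hy => ?_).trans
    (Finset.sum_congr rfl fun y _ => ?_)
  · -- vanishing off `box R`
    dsimp only
    have h0 : F (fun l => s • siteToE (y l)) = 0 := by
      by_contra h
      exact hy (Fintype.mem_piFinset.2 fun l => (hF y h l).1)
    exact Finset.sum_eq_zero fun S _ => by rw [h0, zero_mul, zero_mul]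
  · dsimp only
    rw [hexp, Finset.mul_sum]
    exact Finset.sum_congr rfl fun S _ => mul_assoc _ _ _

/-- Summing a function of the sites over the index set `(q, y, S)` counts each site string `2ⁿ` times per orientation
string (the number of subsets `S ⊆ [n]`): `Σ_{(q,y,S)} g y = 2ⁿ Σ_q Σ_y g y`. -/
theorem sum_idx_eq {n : ℕ} (P : Finset (Fin n → Fin 4 × Fin 4)) (Y : Finset (Fin n → Site 4))
    (g : (Fin n → Site 4) → ℝ) :
    ∑ i ∈ P ×ˢ (Y ×ˢ (Finset.univ : Finset (Fin n)).powerset), g i.2.1 = 2 ^ n * ∑ _q ∈ P, ∑ y ∈ Y, g y := by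
  rw [Finset.sum_product, Finset.mul_sum]
  refine Finset.sum_congr rfl fun q _ => ?_
  rw [Finset.sum_product, Finset.mul_sum]
  refine Finset.sum_congr rfl fun y _ => ?_
  dsimp only
  rw [Finset.sum_const, Finset.card_powerset, Finset.card_univ, Fintype.card_fin, nsmul_eq_mul]
  push_cast
  ring

end Anchor

/-! ## §4 The anchor -/

open Anchor

/-- **The H3 anchor of the reflection-positivity rope** (registered helper of `stub_rope`): there are the H3 rate
`c₁ > 0`, threshold `β₂`, torus-size demand `S₁g` and constants `D n R ≥ 1`, monotone in `R`, such that for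
`β ≥ β₂`, `S₁g β ≤ L`, `R + M ≤ L`, every scale `s` and every test function `F` whose lattice values vanish unless all
sites lie in `box R` at positive times, the reflected, `τ_M`-shifted connected autocorrelation of the smeared field
`X = fieldObs r L s F m` (`m` the torus plane means) is at most `(Σ_q Σ_{y ∈ box Rⁿ} ‖F(s y)‖)² · D n R · e^{−c₁ a(β) M}`:
`X` is a finite combination of uncentred plane products (§3), `osCorr` is sesquilinear (§1), each pair correlation is a
`latticeConnectedCorr` of two β-independent species (§2) bounded by H3, and the H3 constants of the finitely many
species with sites in `box R` are summed into `D n R`. -/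
theorem exists_anchor : ∀ {G : Type} [Group G] [TopologicalSpace G] [IsTopologicalGroup G] [CompactSpace G]
    [MeasurableSpace G] [BorelSpace G] (r : LatticeRep G) {a : ℝ → ℝ} (hgap : GapInUnits G r a), ∃ (c₁ β₂ : ℝ) (S₁g
    : ℝ → ℕ) (D : ℕ → ℕ → ℝ), 0 < c₁ ∧ (∀ n, Monotone (D n)) ∧ (∀ n R, 1 ≤ D n R) ∧ ∀ (β : ℝ), β₂ ≤ β → ∀ (L : ℕ),
    S₁g β ≤ L → ∀ (M R : ℕ), R + M ≤ L → ∀ (s : ℝ) {n : ℕ} (F : 𝓢((Fin n → EuclideanSpace ℝ (Fin 4)), ℂ)), (∀ y :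
    Fin n → Site 4, F (fun l => s • siteToE (y l)) ≠ 0 → ∀ l, y l ∈ box 4 R ∧ 1 ≤ y l 0) → ‖osCorr (wilsonMeasure
    (d := 4) (L := 2 * L + 1) r.ρ β) GaugeConfig.timeReflect (⇑(torusTimeShift (2 * L + 1) M)) (fieldObs r L s F
    (fun pl => wilsonTorusMean r.ρ β L (fun U => plaquetteObs r.ρ 0 pl.1 pl.2 U))) (fieldObs r L s F (fun pl =>
    wilsonTorusMean r.ρ β L (fun U => plaquetteObs r.ρ 0 pl.1 pl.2 U)))‖ ≤ (∑ _q ∈ Fintype.piFinset (fun _ : Fin n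
    => Finset.univ.filter fun pl : Fin 4 × Fin 4 => pl.1 < pl.2), ∑ y ∈ Fintype.piFinset (fun _ : Fin n => box 4
    R), ‖F (fun l => s • siteToE (y l))‖) ^ 2 * D n R * Real.exp (-(c₁ * a β * M)) := by
  intro G _ _ _ _ _ _ r a hgap
  obtain ⟨c₁, β₂, S₁, hc₁, hH3⟩ := hgap
  choose C hC using hH3
  choose spec hspec using fun (n : ℕ) (S : Finset (Fin n)) (q : Fin n → Fin 4 × Fin 4) (z : Fin n → Site 4) =>
    exists_species_prod_plane r S q z
  obtain ⟨Cp, hCp⟩ := exists_abs_plane_le (G := G) r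
  -- the index sets `(q, y, S)`, the pair constants, and `D`
  set I : (n : ℕ) → ℕ → Finset ((Fin n → Fin 4 × Fin 4) × (Fin n → Site 4) × Finset (Fin n)) := fun n R =>
    (Fintype.piFinset fun _ : Fin n => Finset.univ.filter fun pl : Fin 4 × Fin 4 => pl.1 < pl.2) ×ˢ
      ((Fintype.piFinset fun _ : Fin n => box 4 R) ×ˢ (Finset.univ : Finset (Fin n)).powerset) with hI
  set K : (n : ℕ) → ((Fin n → Fin 4 × Fin 4) × (Fin n → Site 4) × Finset (Fin n)) →
      ((Fin n → Fin 4 × Fin 4) × (Fin n → Site 4) × Finset (Fin n)) → ℝ := fun n i j =>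
    |C (spec n i.2.2 i.1 fun l => thetaSite (i.1 l) (i.2.1 l)) (spec n j.2.2 j.1 j.2.1)| with hK
  set D : ℕ → ℕ → ℝ := fun n R =>
    1 + 2 ^ n * 2 ^ n * max 1 Cp ^ n * max 1 Cp ^ n * ∑ i ∈ I n R, ∑ j ∈ I n R, K n i j with hD
  have hB1 : 1 ≤ max 1 Cp := le_max_left _ _
  have hKn : ∀ n i j, 0 ≤ K n i j := fun n i j => abs_nonneg _
  refine ⟨c₁, β₂, S₁, D, hc₁, fun n R R' hRR' => ?_, fun n R => ?_, ?_⟩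
  · -- monotonicity in `R`
    have hsub : I n R ⊆ I n R' := Finset.product_subset_product subset_rfl
      (Finset.product_subset_product (Fintype.piFinset_subset _ _ fun _ => box_mono 4 hRR') subset_rfl)
    have hsum : ∑ i ∈ I n R, ∑ j ∈ I n R, K n i j ≤ ∑ i ∈ I n R', ∑ j ∈ I n R', K n i j :=
      (Finset.sum_le_sum fun i _ => Finset.sum_le_sum_of_subset_of_nonneg hsub fun j _ _ => hKn n i j).trans
        (Finset.sum_le_sum_of_subset_of_nonneg hsub fun i _ _ => Finset.sum_nonneg fun j _ => hKn n i j)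
    show (1 : ℝ) + _ ≤ 1 + _
    have h0 : (0 : ℝ) ≤ 2 ^ n * 2 ^ n * max 1 Cp ^ n * max 1 Cp ^ n := by positivity
    linarith [mul_le_mul_of_nonneg_left hsum h0]
  · show (1 : ℝ) ≤ 1 + _
    exact le_add_of_nonneg_right (mul_nonneg (by positivity)
      (Finset.sum_nonneg fun i _ => Finset.sum_nonneg fun j _ => hKn n i j))
  -- the bound
  intro β hβ L hL M R hRM s n F hF
  have hRL : R ≤ L := by omega
  have hML : M ≤ L := by omega
  set μ := wilsonMeasure (d := 4) (L := 2 * L + 1) (G := G) r.ρ β with hμ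
  haveI : IsProbabilityMeasure μ := isProbabilityMeasure_wilsonMeasure (d := 4) (L := 2 * L + 1) r.ρ r.continuous β
  set m : Fin 4 × Fin 4 → ℝ := fun pl => wilsonTorusMean r.ρ β L (fun U => plaquetteObs r.ρ 0 pl.1 pl.2 U) with hm
  -- the centring constants are bounded by the plane sup
  have hmb : ∀ pl, |m pl| ≤ max 1 Cp := fun pl => by
    refine le_trans ?_ (le_max_right 1 Cp)
    have h := norm_integral_le_of_norm_le_const (μ := μ) (C := Cp)
      (f := fun U : GaugeConfig 4 (2 * L + 1) G => plaquetteObs r.ρ 0 pl.1 pl.2 (torusLift (2 * L + 1) U))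
      (Eventually.of_forall fun U => by
        rw [Real.norm_eq_abs, ← plane_eq_plaquetteObs r pl 0]
        exact hCp pl 0 _)
    rw [probReal_univ, mul_one, Real.norm_eq_abs] at h
    exact h
  -- coefficients and observables of the expansion of `X`
  set c : (Fin n → Fin 4 × Fin 4) × (Fin n → Site 4) × Finset (Fin n) → ℂ := fun i =>
    F (fun l => s • siteToE (i.2.1 l)) * ∏ l ∈ Finset.univ \ i.2.2, (-(m (i.1 l) : ℂ)) with hc
  set Xo : (Fin n → Fin 4 × Fin 4) × (Fin n → Site 4) × Finset (Fin n) → GaugeConfig 4 (2 * L + 1) G → ℂ :=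
    fun i U => ((∏ l ∈ i.2.2, plane G r (i.1 l) (i.2.1 l) (torusLift (2 * L + 1) U) : ℝ) : ℂ) with hXo
  have hX : fieldObs r L s F m = fun U => ∑ i ∈ I n R, c i * Xo i U :=
    funext fun U => fieldObs_eq_sum r hRL s F hF m U
  have hΘm : Measurable (GaugeConfig.timeReflect : GaugeConfig 4 (2 * L + 1) G → GaugeConfig 4 (2 * L + 1) G) :=
    WilsonRP.measurable_timeReflect
  have hτm : Measurable (⇑(torusTimeShift (G := G) (2 * L + 1) M)) := (torusTimeShift (2 * L + 1) M).measurable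
  have hXm : ∀ i, Measurable (Xo i) := fun i =>
    Complex.measurable_ofReal.comp (Finset.measurable_prod _ fun l _ => measurable_plane_lift r L (i.1 l) (i.2.1 l))
  have hXb : ∀ i, ∃ B, ∀ U, ‖Xo i U‖ ≤ B := fun i => ⟨∏ _l ∈ i.2.2, Cp, fun U => by
    show ‖((∏ l ∈ i.2.2, plane G r (i.1 l) (i.2.1 l) (torusLift (2 * L + 1) U) : ℝ) : ℂ)‖ ≤ _
    rw [Complex.norm_real, Real.norm_eq_abs, Finset.abs_prod]
    exact Finset.prod_le_prod (fun _ _ => abs_nonneg _) fun l _ => hCp _ _ _⟩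
  have hw : ∀ i ∈ I n R, ‖c i‖ ≤ ‖F (fun l => s • siteToE (i.2.1 l))‖ * max 1 Cp ^ n := fun i _ => by
    show ‖F (fun l => s • siteToE (i.2.1 l)) * ∏ l ∈ Finset.univ \ i.2.2, (-(m (i.1 l) : ℂ))‖ ≤ _
    rw [norm_mul, norm_prod]
    refine mul_le_mul_of_nonneg_left ?_ (norm_nonneg _)
    calc ∏ l ∈ Finset.univ \ i.2.2, ‖(-(m (i.1 l) : ℂ))‖ ≤ ∏ _l ∈ Finset.univ \ i.2.2, max 1 Cp :=
          Finset.prod_le_prod (fun _ _ => norm_nonneg _) fun l _ => by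
            rw [norm_neg, Complex.norm_real, Real.norm_eq_abs]
            exact hmb (i.1 l)
      _ = max 1 Cp ^ (Finset.univ \ i.2.2).card := Finset.prod_const _
      _ ≤ max 1 Cp ^ n := pow_le_pow_right₀ hB1 (by simpa using Finset.card_le_univ (Finset.univ \ i.2.2))
  -- H3 on each pair of uncentred species
  have hKij : ∀ i ∈ I n R, ∀ j ∈ I n R,
      ‖osCorr μ GaugeConfig.timeReflect (⇑(torusTimeShift (2 * L + 1) M)) (Xo i) (Xo j)‖ ≤
        K n i j * Real.exp (-(c₁ * a β * M)) := fun i hi j _ => by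
    have hq : ∀ l, (i.1 l).1 < (i.1 l).2 := (mem_planeStrings_iff'' i.1).1 (Finset.mem_product.1 hi).1
    have h : osCorr μ GaugeConfig.timeReflect (⇑(torusTimeShift (2 * L + 1) M)) (Xo i) (Xo j) =
        (latticeConnectedCorr r.ρ β (2 * L + 1) (spec n i.2.2 i.1 fun l => thetaSite (i.1 l) (i.2.1 l)).F
          (spec n j.2.2 j.1 j.2.1).F M : ℂ) :=
      osCorr_prodPlane_eq r β L M (fun l _ => hq l) i.2.1 j.1 j.2.2 j.2.1
        (hspec n i.2.2 i.1 fun l => thetaSite (i.1 l) (i.2.1 l)) (hspec n j.2.2 j.1 j.2.1)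
    rw [h, Complex.norm_real, Real.norm_eq_abs]
    exact (hC _ _ β hβ L M hL hML).trans (mul_le_mul_of_nonneg_right (le_abs_self _) (Real.exp_nonneg _))
  have hsum : ∑ i ∈ I n R, ‖F (fun l => s • siteToE (i.2.1 l))‖ =
      2 ^ n * ∑ _q ∈ Fintype.piFinset (fun _ : Fin n => Finset.univ.filter fun pl : Fin 4 × Fin 4 => pl.1 < pl.2),
        ∑ y ∈ Fintype.piFinset (fun _ : Fin n => box 4 R), ‖F (fun l => s • siteToE (y l))‖ :=
    sum_idx_eq _ _ fun y => ‖F (fun l => s • siteToE (y l))‖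
  -- assemble
  rw [hX]
  refine (norm_osCorr_sum_le hΘm hτm (I n R) c hXm hXb (by positivity) hw (fun i _ => norm_nonneg _)
    (Real.exp_nonneg _) (fun i _ j _ => hKn n i j) hKij).trans ?_
  rw [hsum]
  calc (2 ^ n * ∑ _q ∈ Fintype.piFinset (fun _ : Fin n => Finset.univ.filter fun pl : Fin 4 × Fin 4 => pl.1 < pl.2),
          ∑ y ∈ Fintype.piFinset (fun _ : Fin n => box 4 R), ‖F (fun l => s • siteToE (y l))‖) ^ 2 *
        (max 1 Cp ^ n * max 1 Cp ^ n * ∑ i ∈ I n R, ∑ j ∈ I n R, K n i j) * Real.exp (-(c₁ * a β * M))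
      = (∑ _q ∈ Fintype.piFinset (fun _ : Fin n => Finset.univ.filter fun pl : Fin 4 × Fin 4 => pl.1 < pl.2),
          ∑ y ∈ Fintype.piFinset (fun _ : Fin n => box 4 R), ‖F (fun l => s • siteToE (y l))‖) ^ 2 *
        (2 ^ n * 2 ^ n * max 1 Cp ^ n * max 1 Cp ^ n * ∑ i ∈ I n R, ∑ j ∈ I n R, K n i j) *
          Real.exp (-(c₁ * a β * M)) := by ring
    _ ≤ _ := by
      gcongr
      exact le_add_of_nonneg_left zero_le_one

end Summit.QuantumFields.YangMills.Theorems.OSLegsAtWeakCouplingC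

end
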